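import Mathlib.NumberTheory.Harmonic.Bounds
import Literature.NumberTheory.Sieve.SmoothRoughDecomposition
import HarnessLib

/-!
# Bombieri–Vinogradov for the `Ω`-cells of the rough integers, II: elementary counting in classes

Topic `Literature/NumberTheory/Sieve`, sub-namespace `RoughCellsAP`.  Everything here is PROVED
and elementary: the "trivial bounds" used for the boundary boxes and the non-squarefree members in
the proof of the averaged equidistribution of the `Ω`-cells of the rough integers (Motohashi 1976;
Bombieri–Friedlander–Iwaniec 1986, Theorem 0), summed over the moduli `q ≤ Q`:

* `card_Icc_filter_dvd_modEq_le` — `#{lo < b ≤ T : u ∣ b, b ≡ c (q)} ≤ (T − lo)/(uq) + 1` for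
  `(u, q) = 1` (the solutions form one class modulo `uq`); `card_Icc_filter_modEq_le` (`u = 1`);
* `sum_Icc_inv_le_one_add_log` — `Σ_{q ≤ Q} 1/q ≤ 1 + log Q` (Mathlib's harmonic bound), and the
  summed forms `sum_card_Icc_filter_modEq_le`;
* `card_nonSquarefree_rough_modEq_le`, `sum_card_nonSquarefree_rough_modEq_le` — the `N₀`-rough
  non-squarefree `b ≤ T` in a reduced class number `≤ T/((N₀ − 1) q) + √T`, and summed over
  `q ≤ Q` at most `T (1 + log Q)/(N₀ − 1) + Q √T` (a rough non-squarefree `b` is divisible by `p²`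
  for a prime `p ≥ N₀`, and `Σ_{p ≥ N₀} 1/p² ≤ 1/(N₀ − 1)`).

## References

* E. Bombieri, J. B. Friedlander, H. Iwaniec, *Primes in arithmetic progressions to large moduli*,
  Acta Math. 156 (1986), 203–251, §2. [BombieriFriedlanderIwaniecActa1986]
-/

open Finset

namespace Literature.NumberTheory.Sieve

namespace RoughCellsAP

/-! ### One class modulo `uq` -/

/-- **At most `(T − lo)/(uq) + 1` multiples of `u` in `(lo, T]` lie in a class modulo `q`** when
`(u, q) = 1`: two of them are congruent modulo `uq`. [folklore] -/
theorem card_Icc_filter_dvd_modEq_le {u q : ℕ} (hu : 0 < u) (hq : 0 < q) (huq : u.Coprime q)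
    {T lo : ℕ} (hlo : lo ≤ T) (c : ℕ) :
    (#((Finset.Icc 1 T).filter (fun b : ℕ => u ∣ b ∧ lo < b ∧ b ≡ c [MOD q])) : ℝ) ≤
      ((T : ℝ) - lo) / ((u : ℝ) * q) + 1 := by
  set s := (Finset.Icc 1 T).filter (fun b : ℕ => u ∣ b ∧ lo < b ∧ b ≡ c [MOD q]) with hs
  have huq0 : 0 < u * q := Nat.mul_pos hu hq
  -- two members are congruent modulo `uq`
  have hcong : ∀ b ∈ s, ∀ b' ∈ s, b ≡ b' [MOD u * q] := by
    intro b hb b' hb'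
    rw [hs, Finset.mem_filter] at hb hb'
    exact (Nat.modEq_and_modEq_iff_modEq_mul huq).1
      ⟨(Nat.modEq_zero_iff_dvd.2 hb.2.1).trans (Nat.modEq_zero_iff_dvd.2 hb'.2.1).symm,
        hb.2.2.2.trans hb'.2.2.2.symm⟩
  -- the map `b ↦ (b - (lo + 1))/(uq)` is injective on `s` with values `≤ (T - (lo + 1))/(uq)`
  have hmaps : Set.MapsTo (fun b : ℕ => (b - (lo + 1)) / (u * q)) (s : Set ℕ)
      ((Finset.range ((T - (lo + 1)) / (u * q) + 1)) : Set ℕ) := by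
    intro b hb
    rw [Finset.mem_coe, hs, Finset.mem_filter, Finset.mem_Icc] at hb
    rw [Finset.mem_coe, Finset.mem_range, Nat.lt_add_one_iff]
    exact Nat.div_le_div_right (by omega)
  have hinj : Set.InjOn (fun b : ℕ => (b - (lo + 1)) / (u * q)) (s : Set ℕ) := by
    intro b hb b' hb' h
    have hc := hcong b hb b' hb'
    rw [Finset.mem_coe, hs, Finset.mem_filter] at hb hb'
    have hb1 : lo + 1 ≤ b := hb.2.2.1
    have hb1' : lo + 1 ≤ b' := hb'.2.2.1
    have hc' : (b - (lo + 1)) % (u * q) = (b' - (lo + 1)) % (u * q) := by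
      have h3 : b - (lo + 1) ≡ b' - (lo + 1) [MOD u * q] := by
        refine Nat.ModEq.add_right_cancel' (lo + 1) ?_
        rw [Nat.sub_add_cancel hb1, Nat.sub_add_cancel hb1']; exact hc
      exact h3
    simp only at h
    have heq : b - (lo + 1) = b' - (lo + 1) := by
      rw [← Nat.div_add_mod (b - (lo + 1)) (u * q), h, hc', Nat.div_add_mod]
    omega
  have hcard := Finset.card_le_card_of_injOn _ hmaps hinj
  rw [Finset.card_range] at hcard
  have h1 : (#s : ℝ) ≤ ((T - (lo + 1)) / (u * q) : ℕ) + 1 := by exact_mod_cast hcard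
  have h2 : (((T - (lo + 1)) / (u * q) : ℕ) : ℝ) ≤ ((T : ℝ) - lo) / ((u : ℝ) * q) :=
    calc (((T - (lo + 1)) / (u * q) : ℕ) : ℝ) ≤ ((T - (lo + 1) : ℕ) : ℝ) / ((u * q : ℕ) : ℝ) := Nat.cast_div_le
      _ ≤ ((T : ℝ) - lo) / ((u : ℝ) * q) := by
          rw [Nat.cast_mul]
          refine div_le_div_of_nonneg_right ?_ (by positivity)
          have : ((T - (lo + 1) : ℕ) : ℝ) ≤ (T : ℝ) - lo := by
            rcases le_or_gt (lo + 1) T with h | h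
            · rw [Nat.cast_sub h]; push_cast; linarith
            · rw [Nat.sub_eq_zero_of_le h.le]
              have : (lo : ℝ) ≤ T := by exact_mod_cast hlo
              push_cast; linarith
          exact this
  linarith

/-- The case `u = 1`: `#{lo < b ≤ T : b ≡ c (q)} ≤ (T − lo)/q + 1`. [folklore] -/
theorem card_Icc_filter_modEq_le {q : ℕ} (hq : 0 < q) {T lo : ℕ} (hlo : lo ≤ T) (c : ℕ) :
    (#((Finset.Icc 1 T).filter (fun b : ℕ => lo < b ∧ b ≡ c [MOD q])) : ℝ) ≤ ((T : ℝ) - lo) / q + 1 := by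
  have h := card_Icc_filter_dvd_modEq_le Nat.one_pos hq (Nat.coprime_one_left q) hlo c
  rw [Nat.cast_one, one_mul] at h
  refine le_trans (le_of_eq ?_) h
  congr 2
  exact Finset.filter_congr fun b _ => by simp only [one_dvd, true_and]

/-! ### Sums over the moduli -/

/-- `Σ_{1 ≤ q ≤ Q} 1/q ≤ 1 + log Q` (for `Q ≥ 1`; Mathlib's `harmonic_le_one_add_log`). [folklore] -/
theorem sum_Icc_inv_le_one_add_log (Q : ℕ) :
    ∑ q ∈ Finset.Icc 1 Q, (1 : ℝ) / q ≤ 1 + Real.log Q := by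
  have h := harmonic_le_one_add_log Q
  rw [harmonic_eq_sum_Icc, Rat.cast_sum] at h
  refine le_trans (le_of_eq (Finset.sum_congr rfl fun q _ => ?_)) h
  rw [Rat.cast_inv, Rat.cast_natCast, one_div]

/-- `Σ_{1 ≤ q ≤ Q} (a/q + e) ≤ a (1 + log Q) + Q e` for `a ≥ 0`, `Q ≥ 1`. [folklore] -/
theorem sum_Icc_div_add_le (Q : ℕ) {a : ℝ} (ha : 0 ≤ a) (e : ℝ) :
    ∑ q ∈ Finset.Icc 1 Q, (a / q + e) ≤ a * (1 + Real.log Q) + Q * e := by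
  rw [Finset.sum_add_distrib, Finset.sum_const, Nat.card_Icc, Nat.add_sub_cancel, nsmul_eq_mul]
  have h : ∑ q ∈ Finset.Icc 1 Q, a / (q : ℝ) = a * ∑ q ∈ Finset.Icc 1 Q, (1 : ℝ) / q := by
    rw [Finset.mul_sum]
    refine Finset.sum_congr rfl fun q _ => ?_
    rw [mul_one_div]
  have h' : ∑ q ∈ Finset.Icc 1 Q, a / (q : ℝ) ≤ a * (1 + Real.log Q) := by
    rw [h]
    exact mul_le_mul_of_nonneg_left (sum_Icc_inv_le_one_add_log Q) ha
  linarith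

/-- **Boundary strips summed over the moduli**:
`Σ_{q ≤ Q} #{lo < b ≤ T : b ≡ c_q (q)} ≤ (T − lo)(1 + log Q) + Q`. [folklore] -/
theorem sum_card_Icc_filter_modEq_le (Q : ℕ) {T lo : ℕ} (hlo : lo ≤ T) (c : ℕ → ℕ) :
    ∑ q ∈ Finset.Icc 1 Q, (#((Finset.Icc 1 T).filter (fun b : ℕ => lo < b ∧ b ≡ c q [MOD q])) : ℝ) ≤
      ((T : ℝ) - lo) * (1 + Real.log Q) + Q := by
  have hT : (0 : ℝ) ≤ (T : ℝ) - lo := by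
    have : (lo : ℝ) ≤ T := by exact_mod_cast hlo
    linarith
  have h := sum_Icc_div_add_le Q hT 1
  rw [mul_one] at h
  refine le_trans (Finset.sum_le_sum fun q hq => ?_) h
  exact card_Icc_filter_modEq_le (Finset.mem_Icc.1 hq).1 hlo (c q)

/-! ### Non-squarefree rough integers -/

/-- A non-squarefree `N₀`-rough `b` with `1 ≤ b ≤ T` is divisible by `p²` for a prime
`N₀ ≤ p ≤ √T`. [folklore] -/
theorem exists_prime_sq_dvd_of_not_squarefree {N₀ T b : ℕ} (hb : b ∈ Finset.Icc 1 T)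
    (hsq : ¬ Squarefree b) (hr : ∀ p ∈ b.primeFactors, N₀ ≤ p) :
    ∃ p ∈ (Finset.Icc N₀ (Nat.sqrt T)).filter Nat.Prime, p * p ∣ b := by
  rw [Finset.mem_Icc] at hb
  rw [Nat.squarefree_iff_prime_squarefree] at hsq
  push Not at hsq
  obtain ⟨p, hp, hpb⟩ := hsq
  have hpb1 : p ∣ b := (Dvd.intro_left _ rfl : p ∣ p * p).trans hpb
  refine ⟨p, Finset.mem_filter.2 ⟨Finset.mem_Icc.2 ⟨hr p (Nat.mem_primeFactors.2 ⟨hp, hpb1, by omega⟩), ?_⟩, hp⟩, hpb⟩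
  rw [Nat.le_sqrt]
  exact (Nat.le_of_dvd (by omega) hpb).trans hb.2

/-- Union bound: the non-squarefree rough `b ≤ T` with `P b` number at most
`Σ_{N₀ ≤ p ≤ √T prime} #{b ≤ T : p² ∣ b, P b}`. [folklore] -/
theorem card_nonSquarefree_rough_le_sum {N₀ T : ℕ} (P : ℕ → Prop) [DecidablePred P] :
    #((Finset.Icc 1 T).filter (fun b : ℕ => ¬ Squarefree b ∧ (∀ p ∈ b.primeFactors, N₀ ≤ p) ∧ P b)) ≤
      ∑ p ∈ (Finset.Icc N₀ (Nat.sqrt T)).filter Nat.Prime,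
        #((Finset.Icc 1 T).filter (fun b : ℕ => p * p ∣ b ∧ P b)) := by
  refine le_trans (Finset.card_le_card ?_) Finset.card_biUnion_le
  intro b hb
  rw [Finset.mem_filter] at hb
  obtain ⟨hbI, hsq, hr, hP⟩ := hb
  obtain ⟨p, hp, hpb⟩ := exists_prime_sq_dvd_of_not_squarefree hbI hsq hr
  rw [Finset.mem_biUnion]
  exact ⟨p, hp, Finset.mem_filter.2 ⟨hbI, hpb, hP⟩⟩

/-- For a prime `p`, `q ≥ 1` and `(c, q) = 1`:
`#{b ≤ T : p² ∣ b, b ≡ c (q)} ≤ T/(p² q) + 1` (no solutions if `p ∣ q`). [folklore] -/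
theorem card_Icc_filter_sq_dvd_modEq_le {p q : ℕ} (hp : p.Prime) (hq : 0 < q) {c : ℕ} (hc : c.Coprime q)
    (T : ℕ) :
    (#((Finset.Icc 1 T).filter (fun b : ℕ => p * p ∣ b ∧ b ≡ c [MOD q])) : ℝ) ≤
      (T : ℝ) / ((p : ℝ) * p * q) + 1 := by
  by_cases hpq : p ∣ q
  · -- no solutions: `p ∣ b` and `b ≡ c (q)` force `p ∣ c`, contradicting `(c, q) = 1`
    have hempty : (Finset.Icc 1 T).filter (fun b : ℕ => p * p ∣ b ∧ b ≡ c [MOD q]) = ∅ := by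
      refine Finset.filter_eq_empty_iff.2 fun b _ h => ?_
      have hpb : p ∣ b := (Dvd.intro_left _ rfl : p ∣ p * p).trans h.1
      have hpc : p ∣ c := by
        have h2 : b ≡ c [MOD p] := Nat.ModEq.of_dvd hpq h.2
        exact (Nat.ModEq.dvd_iff h2 (dvd_refl p)).1 hpb
      have : p ∣ Nat.gcd c q := Nat.dvd_gcd hpc hpq
      rw [hc, Nat.dvd_one] at this
      exact hp.one_lt.ne' this
    rw [hempty, Finset.card_empty, Nat.cast_zero]
    positivity
  · have hcop : (p * p).Coprime q :=
      Nat.Coprime.mul_left ((Nat.Prime.coprime_iff_not_dvd hp).2 hpq) ((Nat.Prime.coprime_iff_not_dvd hp).2 hpq)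
    have h := card_Icc_filter_dvd_modEq_le (Nat.mul_pos hp.pos hp.pos) hq hcop (Nat.zero_le T) c
    rw [Nat.cast_zero, sub_zero, Nat.cast_mul] at h
    refine le_trans (le_of_eq ?_) h
    congr 2
    exact Finset.filter_congr fun b hb => by
      have : 0 < b := (Finset.mem_Icc.1 hb).1
      simp only [this, true_and]

/-- `Σ_{N₀ ≤ p ≤ M} 1/(p(p-1)) ≤ 1/(N₀ − 1) − 1/M` for `1 ≤ N₀ − 1 ≤ M` (telescoping). [folklore] -/
theorem sum_Icc_inv_mul_pred_le {N₀ : ℕ} (hN₀ : 2 ≤ N₀) {M : ℕ} (hM : N₀ - 1 ≤ M) :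
    ∑ p ∈ Finset.Icc N₀ M, (1 : ℝ) / ((p : ℝ) * ((p : ℝ) - 1)) ≤ 1 / ((N₀ : ℝ) - 1) - 1 / M := by
  induction M, hM using Nat.le_induction with
  | base =>
      rw [Finset.Icc_eq_empty (by omega), Finset.sum_empty, Nat.cast_sub (by omega), Nat.cast_one, sub_self]
  | succ M hM ih =>
      have hM1 : (1 : ℝ) ≤ M := by exact_mod_cast (show 1 ≤ M by omega)
      rw [Finset.sum_Icc_succ_top (by omega), Nat.cast_succ, add_sub_cancel_right]
      have hstep : 1 / ((M : ℝ) + 1) = 1 / (M : ℝ) - 1 / (((M : ℝ) + 1) * M) := by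
        field_simp; ring
      rw [hstep]
      linarith

/-- `Σ_{N₀ ≤ p ≤ M, p prime} 1/p² ≤ 1/(N₀ − 1)` for `N₀ ≥ 2`. [folklore] -/
theorem sum_primes_inv_sq_le {N₀ : ℕ} (hN₀ : 2 ≤ N₀) (M : ℕ) :
    ∑ p ∈ (Finset.Icc N₀ M).filter Nat.Prime, (1 : ℝ) / ((p : ℝ) * p) ≤ 1 / ((N₀ : ℝ) - 1) := by
  rcases lt_or_ge M (N₀ - 1) with hM | hM
  · rw [Finset.filter_eq_empty_iff.2 (fun p hp _ => by have := Finset.mem_Icc.1 hp; omega)]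
    rw [Finset.sum_empty]
    have : (1 : ℝ) < N₀ := by exact_mod_cast hN₀
    exact div_nonneg zero_le_one (by linarith)
  have hM0 : (0 : ℝ) ≤ 1 / (M : ℝ) := by positivity
  calc ∑ p ∈ (Finset.Icc N₀ M).filter Nat.Prime, (1 : ℝ) / ((p : ℝ) * p)
      ≤ ∑ p ∈ Finset.Icc N₀ M, (1 : ℝ) / ((p : ℝ) * p) :=
        Finset.sum_le_sum_of_subset_of_nonneg (Finset.filter_subset _ _) fun _ _ _ => by positivity
    _ ≤ ∑ p ∈ Finset.Icc N₀ M, (1 : ℝ) / ((p : ℝ) * ((p : ℝ) - 1)) := by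
        refine Finset.sum_le_sum fun p hp => ?_
        have hp2 : (2 : ℝ) ≤ p := by exact_mod_cast hN₀.trans (Finset.mem_Icc.1 hp).1
        exact one_div_le_one_div_of_le (by nlinarith) (by nlinarith)
    _ ≤ 1 / ((N₀ : ℝ) - 1) - 1 / M := sum_Icc_inv_mul_pred_le hN₀ hM
    _ ≤ 1 / ((N₀ : ℝ) - 1) := by linarith

/-- **Non-squarefree rough integers in a reduced class**: for `N₀ ≥ 2`, `q ≥ 1`, `(c, q) = 1`,
`#{b ≤ T : b non-squarefree, N₀-rough, b ≡ c (q)} ≤ T/((N₀ − 1) q) + √T`. [folklore] -/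
theorem card_nonSquarefree_rough_modEq_le {N₀ : ℕ} (hN₀ : 2 ≤ N₀) {q : ℕ} (hq : 0 < q) {c : ℕ}
    (hc : c.Coprime q) (T : ℕ) :
    (#((Finset.Icc 1 T).filter (fun b : ℕ =>
        ¬ Squarefree b ∧ (∀ p ∈ b.primeFactors, N₀ ≤ p) ∧ b ≡ c [MOD q])) : ℝ) ≤
      (T : ℝ) / (((N₀ : ℝ) - 1) * q) + Nat.sqrt T := by
  have h1 := card_nonSquarefree_rough_le_sum (N₀ := N₀) (T := T) (fun b : ℕ => b ≡ c [MOD q])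
  have h2 : ((∑ p ∈ (Finset.Icc N₀ (Nat.sqrt T)).filter Nat.Prime,
      #((Finset.Icc 1 T).filter (fun b : ℕ => p * p ∣ b ∧ b ≡ c [MOD q])) : ℕ) : ℝ) ≤
      ∑ p ∈ (Finset.Icc N₀ (Nat.sqrt T)).filter Nat.Prime, ((T : ℝ) / ((p : ℝ) * p * q) + 1) := by
    push_cast
    exact Finset.sum_le_sum fun p hp => card_Icc_filter_sq_dvd_modEq_le (Finset.mem_filter.1 hp).2 hq hc T
  have h3 : ∑ p ∈ (Finset.Icc N₀ (Nat.sqrt T)).filter Nat.Prime, ((T : ℝ) / ((p : ℝ) * p * q) + 1) ≤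
      (T : ℝ) / (((N₀ : ℝ) - 1) * q) + Nat.sqrt T := by
    rw [Finset.sum_add_distrib, Finset.sum_const, nsmul_eq_mul, mul_one]
    refine add_le_add ?_ ?_
    · have hre : ∀ p ∈ (Finset.Icc N₀ (Nat.sqrt T)).filter Nat.Prime,
          (T : ℝ) / ((p : ℝ) * p * q) = (T : ℝ) / q * (1 / ((p : ℝ) * p)) := by
        intro p hp
        have hp0 : (0 : ℝ) < p := by exact_mod_cast (Finset.mem_filter.1 hp).2.pos
        field_simp
      rw [Finset.sum_congr rfl hre, ← Finset.mul_sum]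
      have hq0 : (0 : ℝ) < q := by exact_mod_cast hq
      have hN : (1 : ℝ) < N₀ := by exact_mod_cast hN₀
      have hN1 : (N₀ : ℝ) - 1 ≠ 0 := ne_of_gt (by linarith)
      calc (T : ℝ) / q * ∑ p ∈ (Finset.Icc N₀ (Nat.sqrt T)).filter Nat.Prime, 1 / ((p : ℝ) * p)
          ≤ (T : ℝ) / q * (1 / ((N₀ : ℝ) - 1)) :=
            mul_le_mul_of_nonneg_left (sum_primes_inv_sq_le hN₀ _) (by positivity)
        _ = (T : ℝ) / (((N₀ : ℝ) - 1) * q) := by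
            rw [div_mul_div_comm, mul_one, mul_comm (q : ℝ)]
    · exact_mod_cast (Finset.card_le_card (Finset.filter_subset _ _)).trans (by rw [Nat.card_Icc]; omega)
  exact (show (_ : ℝ) ≤ _ by exact_mod_cast h1).trans (h2.trans h3)

/-- The same without the congruence: `#{b ≤ T : non-squarefree, N₀-rough} ≤ T/(N₀ − 1) + √T`.
[folklore] -/
theorem card_nonSquarefree_rough_le {N₀ : ℕ} (hN₀ : 2 ≤ N₀) (T : ℕ) :
    (#((Finset.Icc 1 T).filter (fun b : ℕ => ¬ Squarefree b ∧ (∀ p ∈ b.primeFactors, N₀ ≤ p))) : ℝ) ≤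
      (T : ℝ) / ((N₀ : ℝ) - 1) + Nat.sqrt T := by
  have h := card_nonSquarefree_rough_modEq_le hN₀ Nat.one_pos (Nat.coprime_one_right 0) T
  rw [Nat.cast_one, mul_one] at h
  refine le_trans (le_of_eq ?_) h
  congr 2
  exact Finset.filter_congr fun b _ => by simp only [Nat.modEq_one, and_true]

/-- **Summed over the moduli**: for `N₀ ≥ 2`, `Q ≥ 1` and reduced classes `c_q`,
`Σ_{q ≤ Q} #{b ≤ T : non-squarefree, N₀-rough, b ≡ c_q (q)} ≤ T (1 + log Q)/(N₀ − 1) + Q √T`.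
[folklore] -/
theorem sum_card_nonSquarefree_rough_modEq_le {N₀ : ℕ} (hN₀ : 2 ≤ N₀) (Q : ℕ)
    {c : ℕ → ℕ} (hc : ∀ q : ℕ, 0 < q → (c q).Coprime q) (T : ℕ) :
    ∑ q ∈ Finset.Icc 1 Q, (#((Finset.Icc 1 T).filter (fun b : ℕ =>
        ¬ Squarefree b ∧ (∀ p ∈ b.primeFactors, N₀ ≤ p) ∧ b ≡ c q [MOD q])) : ℝ) ≤
      (T : ℝ) / ((N₀ : ℝ) - 1) * (1 + Real.log Q) + Q * Nat.sqrt T := by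
  have hN : (1 : ℝ) < N₀ := by exact_mod_cast hN₀
  have ha : (0 : ℝ) ≤ (T : ℝ) / ((N₀ : ℝ) - 1) := div_nonneg (Nat.cast_nonneg _) (by linarith)
  refine le_trans (Finset.sum_le_sum fun q hq => ?_) (sum_Icc_div_add_le Q ha _)
  have hq0 : 0 < q := (Finset.mem_Icc.1 hq).1
  refine (card_nonSquarefree_rough_modEq_le hN₀ hq0 (hc q hq0) T).trans (le_of_eq ?_)
  have hq' : (0 : ℝ) < q := by exact_mod_cast hq0
  field_simp

end RoughCellsAP

end Literature.NumberTheory.Sieve
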